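import Literature.Analysis.FluidPDE.DuchonRobertProofs
import HarnessLib

/-!
# Duchon–Robert's local 4/3 law for `L³` weak Euler solutions: discharge in every dimension

Topic: Analysis/FluidPDE, proofs. Final assembly for the accepted named fact
`Torus.HasDuchonRobertDefect.hasFourThirdsLaw` (`DissipationAnomaly`; J. Duchon, R. Robert,
*Inertial energy dissipation for weak solutions of incompressible Euler and Navier–Stokes
equations*, Nonlinearity 13 (2000) 249–255, §4 (11)–(12): for a weak Euler solution
`u ∈ L³((0,T) × T^d)` with Duchon–Robert defect `D(u)`, the sphere-averaged energy flux satisfies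
`lim_{ℓ→0⁺} ℓ⁻¹ ⨍ δ_L u |δu|²(ℓω) dω = −(4/d) D(u)` in `𝒟'((0,T) × T^d)`).

**Scope of the printed sources.** Duchon–Robert 2000, §4 (11)–(12) (and Eyink 2003, §1, reporting
it: arXiv:nlin/0208004, p. 3, "Assuming that the following limit exists, `S(u) = 𝒟-lim_{ℓ→0} S(u,ℓ)`,
Duchon and Robert, Section 5 show that `S(u) = −(4/3) D(u)`") print the identification of the shell
limit with `−(4/3) D(u)` *assuming the limit exists*; the fact as vendored asserts the limit for
every `L³` weak Euler solution (cf. Novack 2024, Thm. 1). The tree proves this stronger statement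
along Duchon–Robert's own regularisation: the scale-`ε` local energy identity (Duchon–Robert 2000,
proof of Prop. 2: cubic identity `Torus.integral_kernelFlux_mul_eq_holds` and tested momentum
equation `Torus.symmTestField_identity_holds`) converges *uniformly* over mollifiers supported in
the unit ball (`Torus.hasUniformDuchonRobertDefect_of_steps`, `DuchonRobertUniformDefectOfEuler`),
and a uniform defect forces the shell limit (`Torus.HasUniformDuchonRobertDefect.hasFourThirdsLaw`,
`DuchonRobertUniformDefect`); the pressure `p ∈ L^{3/2}` is reconstructed from `u ∈ L³` by the
Calderón–Zygmund theory on `T^d` (`Torus.exists_pressure_of_tendsto_L3_of`, `DuchonRobertPressure`,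
fed with the torus Hessian bound `FunctionSpaces.Torus.eLpNorm_hessian_le_laplacian_holds`,
`TorusRieszTransformProofs`, itself from Stein's whole-space bound in every dimension,
`stein1970_hessian_Lp_bound_holds`, `HessianLaplacianLpGeneralProofs`).

`DuchonRobertProofs` records the assembly from the pressure fact
(`Torus.hasFourThirdsLaw_of_pressure_fact`) and the unconditional law on tori of dimension `≤ 3`
(`Torus.HasDuchonRobertDefect.hasFourThirdsLaw_holds_fin3`). This file closes the fact as stated,
over an arbitrary finite index type.

## Results (all proved, no named fact introduced)

* `Torus.hasFourThirdsLaw_of_CZ`: the fact from the torus Hessian bound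
  `FunctionSpaces.Torus.eLpNorm_hessian_le_laplacian d` alone;
* `Torus.hasFourThirdsLaw_of_wholeSpace`: from `stein1970_hessian_Lp_bound (EuclideanSpace ℝ d)`;
* `Torus.HasDuchonRobertDefect.hasFourThirdsLaw_holds`: **the discharge of the named fact
  `Torus.HasDuchonRobertDefect.hasFourThirdsLaw` in every dimension.**

## References

* J. Duchon, R. Robert, *Inertial energy dissipation for weak solutions of incompressible Euler and
  Navier–Stokes equations*, Nonlinearity 13 (2000) 249–255: Prop. 2 and its proof (pp. 250–252),
  §4 (11)–(12). [DuchonRobert2000]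
* G. L. Eyink, *Local 4/5-law and energy dissipation anomaly in turbulence*, Nonlinearity 16 (2003)
  137–145 = arXiv:nlin/0208004, §1 (p. 3) and (1.6). [Eyink2003]
* M. Novack, *Scaling laws and exact results in turbulence*, Nonlinearity 37 (2024) 095002 =
  arXiv:2310.01375, Thm. 1. [Novack2024]
* E. M. Stein, *Singular integrals and differentiability properties of functions* (1970), Ch. III
  §1.3 Prop. 3. [Stein1971]
-/

noncomputable section

open MeasureTheory Set Filter

namespace Literature.Analysis.FluidPDE.Torus

variable {d : Type*} [Fintype d] {T : ℝ} {u : ℝ → UnitAddTorus d → EuclideanSpace ℝ d}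

/-- **The local 4/3 law from the torus Calderón–Zygmund bound alone**: every other ingredient of
Duchon–Robert's argument is proved in the tree (`Torus.hasFourThirdsLaw_of_pressure_fact` fed with
`Torus.exists_pressure_of_tendsto_L3_of`). [cite: DuchonRobert2000, §4 (11)–(12)] -/
theorem hasFourThirdsLaw_of_CZ (hCZ : FunctionSpaces.Torus.eLpNorm_hessian_le_laplacian d) :
    HasDuchonRobertDefect.hasFourThirdsLaw (T := T) (u := u) :=
  hasFourThirdsLaw_of_pressure_fact (exists_pressure_of_tendsto_L3_of hCZ)

/-- **The local 4/3 law from Stein's whole-space Hessian bound in dimension `d`**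
(`stein1970_hessian_Lp_bound (EuclideanSpace ℝ d)`, Stein 1970, III §1.3 Prop. 3), through
`Torus.exists_pressure_of_tendsto_L3_of_wholeSpace`. [cite: DuchonRobert2000, §4 (11)–(12)] -/
theorem hasFourThirdsLaw_of_wholeSpace (h : stein1970_hessian_Lp_bound (EuclideanSpace ℝ d)) :
    HasDuchonRobertDefect.hasFourThirdsLaw (T := T) (u := u) :=
  hasFourThirdsLaw_of_pressure_fact (exists_pressure_of_tendsto_L3_of_wholeSpace h)

/-- **Discharge of the named fact `Torus.HasDuchonRobertDefect.hasFourThirdsLaw` in every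
dimension** (Duchon–Robert 2000, §4 (11)–(12), with the existence of the shell limit, which the
source assumes, proved): for every finite index type `d`, every `T`, and every weak Euler solution
`u ∈ L³((0,T) × T^d)` with a Duchon–Robert defect `D`, the sphere-averaged energy flux satisfies
the local 4/3 law `Torus.HasFourThirdsLaw T u D` (constant `4/d`, `= 4/3` for `d = 3`). Assembly:
the torus Hessian bound in every dimension (`FunctionSpaces.Torus.eLpNorm_hessian_le_laplacian_holds`)
⇒ `L^{3/2}` pressure (`Torus.exists_pressure_of_tendsto_L3_of`) ⇒ uniform Duchon–Robert defect
(`Torus.hasUniformDuchonRobertDefect_of_steps`) ⇒ shell limit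
(`Torus.HasUniformDuchonRobertDefect.hasFourThirdsLaw`). [cite: DuchonRobert2000, §4 (11)–(12) and proof of Prop. 2 (pp. 250–252)] -/
theorem HasDuchonRobertDefect.hasFourThirdsLaw_holds :
    HasDuchonRobertDefect.hasFourThirdsLaw (T := T) (u := u) :=
  hasFourThirdsLaw_of_CZ FunctionSpaces.Torus.eLpNorm_hessian_le_laplacian_holds

end Literature.Analysis.FluidPDE.Torus
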